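import Summits.Schanuel.Schanuel.Theorems.TateNomesTateLocusGPCOneTwoNomeTransfer
import Mathlib.NumberTheory.ModularForms.LevelOne.GradedRing
import Literature.Barriers.Schanuel.NesterenkoModularScopeConjectureProofs

/-!
# `TateLocusGPCOne` (crux stmt-Schanuel-17406, route `TateNomes`): the two-nome decoder is faithful

Companion to `TateNomesTateLocusGPCOneTwoNomeTransfer.lean` (line `Sketch`, cards
`Cruxes/TateLocusGPCOne/Ideas/s-dual-second-cusp.md`, `fricke-partner-nome.md`).  There the eight
cusp-values `(q, P, Q, R)(e^{2πiτ}) ∪ (q, P, Q, R)(e^{−2πi/τ})` were shown to lie in the crux field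
`ℚ(2πi, τ, q, P, Q, R)` with the partner nome `q' = e^{−2πi/τ}` adjoined.  Here the CONVERSE
bookkeeping is proved, sorry-free:

* `E₄_ne_zero_or_E₆_ne_zero` — `E₄` and `E₆` have no common zero on `ℍ` (`E₄³ − E₆² = 1728Δ ≠ 0`,
  Mathlib `ModularForm.discriminant_eq_E₄_cube_sub_E₆_sq`, `ModularForm.discriminant_ne_zero`);
* `isAlgebraic_tau_adjoin_twoNome` — `τ` is algebraic over `ℚ(eight)` (`τ⁴ = Q'/Q`, or `τ⁶ = R'/R`);
* `twoPiI_mem_adjoin_twoNome_tau`, `isAlgebraic_twoPiI_adjoin_twoNome` — `2πi = 12τ/(P' − τ²P)` lies in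
  `ℚ(eight)(τ)`, hence is algebraic over `ℚ(eight)` (the `E₂`-anomaly decodes `π`);
* `trdeg_twoNome_eq` — therefore `trdeg ℚ(eight) = trdeg ℚ(2πi, τ, q, P, Q, R, q')`;
* `twoNome_iff_six_insert_partner` — the line's stub "`6 ≤ trdeg ℚ(eight)` for non-quadratic `τ`" is
  EQUIVALENT to "`6 ≤ trdeg ℚ(2πi, τ, q, P, Q, R, q')` for non-quadratic `τ`": the two-nome statement is
  exactly the crux's field plus one exponential asked to carry six independent numbers (GPC dimension
  `6` for `h¹(E_τ) ⊕ [ℤ² → 𝔾_m; (q, q')]`) — strictly more than the crux's `5`, never a weakening.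

No new definitions; sets are literals over `Literature.Barriers.Schanuel.ramanujanP/Q/R` and `cexp`.
-/

noncomputable section

-- single-conjunct summit: `Summit.Schanuel.Schanuel.…` repeats the name by the D-0017 layout
set_option linter.dupNamespace false

open Complex IntermediateField
open UpperHalfPlane hiding I
open scoped Real MatrixGroups
open Literature.Barriers.Schanuel (ramanujanP ramanujanQ ramanujanR ramanujanP_cexp ramanujanQ_cexp
  ramanujanR_cexp)

namespace Summit.Schanuel.Schanuel.Theorems.TateNomesTateLocusGPCOne

/-! ## Converse of the decoder: `τ` and `2πi` are algebraic over the eight cusp-values -/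

/-- `E₄(τ) ≠ 0 ∨ E₆(τ) ≠ 0` on `ℍ` (`E₄³ − E₆² = 1728Δ`, `Δ ≠ 0`; Mathlib). -/
theorem E₄_ne_zero_or_E₆_ne_zero (τ : ℍ) : ModularForm.E₄ τ ≠ 0 ∨ ModularForm.E₆ τ ≠ 0 := by
  by_contra h
  rw [not_or, not_not, not_not] at h
  have hΔ := ModularForm.discriminant_eq_E₄_cube_sub_E₆_sq τ
  rw [h.1, h.2] at hΔ
  exact ModularForm.discriminant_ne_zero τ (by simpa using hΔ)

/-- `Q(q) ≠ 0 ∨ R(q) ≠ 0` at `q = e^{2πiτ}`, `τ ∈ ℍ`. -/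
theorem ramanujanQ_ne_zero_or_ramanujanR_ne_zero (τ : ℍ) :
    ramanujanQ (cexp (2 * π * I * τ)) ≠ 0 ∨ ramanujanR (cexp (2 * π * I * τ)) ≠ 0 := by
  rw [ramanujanQ_cexp, ramanujanR_cexp]
  exact E₄_ne_zero_or_E₆_ne_zero τ

/-- **`τ` is algebraic over `ℚ(q, P, Q, R, q', P', Q', R')`**: `τ⁴ = Q'/Q` when `Q ≠ 0`, else
`τ⁶ = R'/R` (`Q`, `R` do not vanish together). -/
theorem isAlgebraic_tau_adjoin_twoNome (τ : ℍ) :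
    IsAlgebraic ↥(adjoin ℚ ({cexp (2 * π * I * τ), ramanujanP (cexp (2 * π * I * τ)),
        ramanujanQ (cexp (2 * π * I * τ)), ramanujanR (cexp (2 * π * I * τ)),
        cexp (2 * π * I * (-(τ : ℂ)⁻¹)), ramanujanP (cexp (2 * π * I * (-(τ : ℂ)⁻¹))),
        ramanujanQ (cexp (2 * π * I * (-(τ : ℂ)⁻¹))), ramanujanR (cexp (2 * π * I * (-(τ : ℂ)⁻¹)))} :
        Set ℂ)) (τ : ℂ) := by
  set L := adjoin ℚ ({cexp (2 * π * I * τ), ramanujanP (cexp (2 * π * I * τ)),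
        ramanujanQ (cexp (2 * π * I * τ)), ramanujanR (cexp (2 * π * I * τ)),
        cexp (2 * π * I * (-(τ : ℂ)⁻¹)), ramanujanP (cexp (2 * π * I * (-(τ : ℂ)⁻¹))),
        ramanujanQ (cexp (2 * π * I * (-(τ : ℂ)⁻¹))), ramanujanR (cexp (2 * π * I * (-(τ : ℂ)⁻¹)))} :
        Set ℂ) with hL
  have hsub : ({cexp (2 * π * I * τ), ramanujanP (cexp (2 * π * I * τ)),
        ramanujanQ (cexp (2 * π * I * τ)), ramanujanR (cexp (2 * π * I * τ)),
        cexp (2 * π * I * (-(τ : ℂ)⁻¹)), ramanujanP (cexp (2 * π * I * (-(τ : ℂ)⁻¹))),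
        ramanujanQ (cexp (2 * π * I * (-(τ : ℂ)⁻¹))), ramanujanR (cexp (2 * π * I * (-(τ : ℂ)⁻¹)))} :
        Set ℂ) ⊆ L := subset_adjoin ℚ _
  have hQ : ramanujanQ (cexp (2 * π * I * τ)) ∈ L := hsub (by simp)
  have hR : ramanujanR (cexp (2 * π * I * τ)) ∈ L := hsub (by simp)
  have hQ' : ramanujanQ (cexp (2 * π * I * (-(τ : ℂ)⁻¹))) ∈ L := hsub (by simp)
  have hR' : ramanujanR (cexp (2 * π * I * (-(τ : ℂ)⁻¹))) ∈ L := hsub (by simp)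
  -- an element of `L` is algebraic over `L`
  have memAlg : ∀ x : ℂ, x ∈ L → IsAlgebraic L x := fun x hx =>
    isAlgebraic_algebraMap (⟨x, hx⟩ : L)
  rcases ramanujanQ_ne_zero_or_ramanujanR_ne_zero τ with hQ0 | hR0
  · -- `τ⁴ = Q'/Q ∈ L`
    refine IsAlgebraic.of_pow (n := 4) (by norm_num) (memAlg _ ?_)
    have h4 : (τ : ℂ) ^ 4 = ramanujanQ (cexp (2 * π * I * (-(τ : ℂ)⁻¹))) *
        (ramanujanQ (cexp (2 * π * I * τ)))⁻¹ := by
      rw [ramanujanQ_partner, mul_inv_cancel_right₀ hQ0]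
    rw [h4]
    exact mul_mem hQ' (inv_mem hQ)
  · -- `τ⁶ = R'/R ∈ L`
    refine IsAlgebraic.of_pow (n := 6) (by norm_num) (memAlg _ ?_)
    have h6 : (τ : ℂ) ^ 6 = ramanujanR (cexp (2 * π * I * (-(τ : ℂ)⁻¹))) *
        (ramanujanR (cexp (2 * π * I * τ)))⁻¹ := by
      rw [ramanujanR_partner, mul_inv_cancel_right₀ hR0]
    rw [h6]
    exact mul_mem hR' (inv_mem hR)

/-- **`2πi ∈ ℚ(q, P, Q, R, q', P', Q', R')(τ)`**: `2πi = 12τ/(P' − τ²P)` (the `E₂`-anomaly decodes `π`). -/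
theorem twoPiI_mem_adjoin_twoNome_tau (τ : ℍ) :
    2 * (π : ℂ) * I ∈ adjoin ℚ (insert (τ : ℂ) ({cexp (2 * π * I * τ), ramanujanP (cexp (2 * π * I * τ)),
        ramanujanQ (cexp (2 * π * I * τ)), ramanujanR (cexp (2 * π * I * τ)),
        cexp (2 * π * I * (-(τ : ℂ)⁻¹)), ramanujanP (cexp (2 * π * I * (-(τ : ℂ)⁻¹))),
        ramanujanQ (cexp (2 * π * I * (-(τ : ℂ)⁻¹))), ramanujanR (cexp (2 * π * I * (-(τ : ℂ)⁻¹)))} :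
        Set ℂ)) := by
  set K := adjoin ℚ (insert (τ : ℂ) ({cexp (2 * π * I * τ), ramanujanP (cexp (2 * π * I * τ)),
        ramanujanQ (cexp (2 * π * I * τ)), ramanujanR (cexp (2 * π * I * τ)),
        cexp (2 * π * I * (-(τ : ℂ)⁻¹)), ramanujanP (cexp (2 * π * I * (-(τ : ℂ)⁻¹))),
        ramanujanQ (cexp (2 * π * I * (-(τ : ℂ)⁻¹))), ramanujanR (cexp (2 * π * I * (-(τ : ℂ)⁻¹)))} :
        Set ℂ)) with hK
  have hsub : insert (τ : ℂ) ({cexp (2 * π * I * τ), ramanujanP (cexp (2 * π * I * τ)),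
        ramanujanQ (cexp (2 * π * I * τ)), ramanujanR (cexp (2 * π * I * τ)),
        cexp (2 * π * I * (-(τ : ℂ)⁻¹)), ramanujanP (cexp (2 * π * I * (-(τ : ℂ)⁻¹))),
        ramanujanQ (cexp (2 * π * I * (-(τ : ℂ)⁻¹))), ramanujanR (cexp (2 * π * I * (-(τ : ℂ)⁻¹)))} :
        Set ℂ) ⊆ K := subset_adjoin ℚ _
  have hτ : (τ : ℂ) ∈ K := hsub (Set.mem_insert _ _)
  have hP : ramanujanP (cexp (2 * π * I * τ)) ∈ K := hsub (by simp)
  have hP' : ramanujanP (cexp (2 * π * I * (-(τ : ℂ)⁻¹))) ∈ K := hsub (by simp)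
  have hτ0 : (τ : ℂ) ≠ 0 := τ.ne_zero
  have hπ : (π : ℂ) ≠ 0 := ofReal_ne_zero.2 Real.pi_ne_zero
  have h2pi0 : 2 * (π : ℂ) * I ≠ 0 := by simp [hπ, I_ne_zero]
  -- `P' − τ²P = 12τ/(2πi)`, so `2πi = 12τ (P' − τ²P)⁻¹`
  have hdiff : ramanujanP (cexp (2 * π * I * (-(τ : ℂ)⁻¹))) -
      (τ : ℂ) ^ 2 * ramanujanP (cexp (2 * π * I * τ)) = 12 * (τ : ℂ) * (2 * (π : ℂ) * I)⁻¹ := by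
    rw [ramanujanP_partner]; ring
  have hkey : 2 * (π : ℂ) * I = 12 * (τ : ℂ) * (ramanujanP (cexp (2 * π * I * (-(τ : ℂ)⁻¹))) -
      (τ : ℂ) ^ 2 * ramanujanP (cexp (2 * π * I * τ)))⁻¹ := by
    rw [hdiff]
    field_simp
  rw [hkey]
  exact mul_mem (mul_mem (ofNat_mem K 12) hτ) (inv_mem (sub_mem hP' (mul_mem (pow_mem hτ 2) hP)))

/-- **`2πi` is algebraic over `ℚ(q, P, Q, R, q', P', Q', R')`** (it lies in that field with `τ`
adjoined, and `τ` is algebraic over it). -/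
theorem isAlgebraic_twoPiI_adjoin_twoNome (τ : ℍ) :
    IsAlgebraic ↥(adjoin ℚ ({cexp (2 * π * I * τ), ramanujanP (cexp (2 * π * I * τ)),
        ramanujanQ (cexp (2 * π * I * τ)), ramanujanR (cexp (2 * π * I * τ)),
        cexp (2 * π * I * (-(τ : ℂ)⁻¹)), ramanujanP (cexp (2 * π * I * (-(τ : ℂ)⁻¹))),
        ramanujanQ (cexp (2 * π * I * (-(τ : ℂ)⁻¹))), ramanujanR (cexp (2 * π * I * (-(τ : ℂ)⁻¹)))} :
        Set ℂ)) (2 * (π : ℂ) * I) := by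
  set E8 : Set ℂ := ({cexp (2 * π * I * τ), ramanujanP (cexp (2 * π * I * τ)),
        ramanujanQ (cexp (2 * π * I * τ)), ramanujanR (cexp (2 * π * I * τ)),
        cexp (2 * π * I * (-(τ : ℂ)⁻¹)), ramanujanP (cexp (2 * π * I * (-(τ : ℂ)⁻¹))),
        ramanujanQ (cexp (2 * π * I * (-(τ : ℂ)⁻¹))), ramanujanR (cexp (2 * π * I * (-(τ : ℂ)⁻¹)))} :
        Set ℂ) with hE8
  have hτalg : IsAlgebraic (adjoin ℚ E8) (τ : ℂ) := isAlgebraic_tau_adjoin_twoNome τ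
  -- `2πi ∈ ℚ(E8)(τ)` (as a subset of `ℂ`; `adjoin_adjoin_left` through the carrier sets)
  have e := adjoin_adjoin_left ℚ E8 ({(τ : ℂ)} : Set ℂ)
  rw [Set.union_singleton] at e
  have hset : ((adjoin (adjoin ℚ E8) ({(τ : ℂ)} : Set ℂ) :
      IntermediateField (adjoin ℚ E8) ℂ) : Set ℂ) = (adjoin ℚ (insert (τ : ℂ) E8) : Set ℂ) := by
    rw [← e, coe_restrictScalars]
  have hmem : 2 * (π : ℂ) * I ∈ adjoin (adjoin ℚ E8) ({(τ : ℂ)} : Set ℂ) := by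
    rw [← SetLike.mem_coe, hset, SetLike.mem_coe]
    exact twoPiI_mem_adjoin_twoNome_tau τ
  haveI : Algebra.IsAlgebraic (adjoin ℚ E8) (adjoin (adjoin ℚ E8) ({(τ : ℂ)} : Set ℂ)) :=
    IntermediateField.isAlgebraic_adjoin fun x hx => by
      rw [Set.mem_singleton_iff] at hx
      rw [hx]
      exact hτalg.isIntegral
  have hy : IsAlgebraic (adjoin ℚ E8)
      (⟨2 * (π : ℂ) * I, hmem⟩ : adjoin (adjoin ℚ E8) ({(τ : ℂ)} : Set ℂ)) :=
    Algebra.IsAlgebraic.isAlgebraic _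
  exact hy.algHom (adjoin (adjoin ℚ E8) ({(τ : ℂ)} : Set ℂ)).val

/-- **Decoder equality of transcendence degrees**: `trdeg ℚ(eight) = trdeg ℚ(2πi, τ, q, P, Q, R)(q')` —
the crux field with the partner nome adjoined is algebraic over the field of the eight cusp-values. -/
theorem trdeg_twoNome_eq (τ : ℍ) :
    Algebra.trdeg ℚ ↥(adjoin ℚ ({cexp (2 * π * I * τ), ramanujanP (cexp (2 * π * I * τ)),
        ramanujanQ (cexp (2 * π * I * τ)), ramanujanR (cexp (2 * π * I * τ)),
        cexp (2 * π * I * (-(τ : ℂ)⁻¹)), ramanujanP (cexp (2 * π * I * (-(τ : ℂ)⁻¹))),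
        ramanujanQ (cexp (2 * π * I * (-(τ : ℂ)⁻¹))), ramanujanR (cexp (2 * π * I * (-(τ : ℂ)⁻¹)))} :
        Set ℂ)) =
      Algebra.trdeg ℚ ↥(adjoin ℚ (insert (cexp (2 * π * I * (-(τ : ℂ)⁻¹)))
        ({2 * (π : ℂ) * I, (τ : ℂ), cexp (2 * π * I * τ), ramanujanP (cexp (2 * π * I * τ)),
          ramanujanQ (cexp (2 * π * I * τ)), ramanujanR (cexp (2 * π * I * τ))} : Set ℂ))) := by
  set E8 : Set ℂ := ({cexp (2 * π * I * τ), ramanujanP (cexp (2 * π * I * τ)),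
        ramanujanQ (cexp (2 * π * I * τ)), ramanujanR (cexp (2 * π * I * τ)),
        cexp (2 * π * I * (-(τ : ℂ)⁻¹)), ramanujanP (cexp (2 * π * I * (-(τ : ℂ)⁻¹))),
        ramanujanQ (cexp (2 * π * I * (-(τ : ℂ)⁻¹))), ramanujanR (cexp (2 * π * I * (-(τ : ℂ)⁻¹)))} :
        Set ℂ) with hE8
  set S7 : Set ℂ := insert (cexp (2 * π * I * (-(τ : ℂ)⁻¹)))
        ({2 * (π : ℂ) * I, (τ : ℂ), cexp (2 * π * I * τ), ramanujanP (cexp (2 * π * I * τ)),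
          ramanujanQ (cexp (2 * π * I * τ)), ramanujanR (cexp (2 * π * I * τ))} : Set ℂ) with hS7
  apply le_antisymm
  · have hle : adjoin ℚ E8 ≤ adjoin ℚ S7 := adjoin_twoNome_le τ
    exact trdeg_le_of_injective (inclusion hle) (inclusion_injective hle)
  · -- `S7 ⊆ ℚ(E8 ∪ {τ, 2πi})` and `τ, 2πi` are algebraic over `ℚ(E8)`
    have hle : adjoin ℚ S7 ≤ adjoin ℚ (E8 ∪ {(τ : ℂ), 2 * (π : ℂ) * I}) := by
      refine adjoin_le_iff.mpr ?_
      have hsub : E8 ∪ {(τ : ℂ), 2 * (π : ℂ) * I} ⊆ adjoin ℚ (E8 ∪ {(τ : ℂ), 2 * (π : ℂ) * I}) :=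
        subset_adjoin ℚ _
      intro x hx
      simp only [hS7, Set.mem_insert_iff, Set.mem_singleton_iff] at hx
      rcases hx with rfl | rfl | rfl | rfl | rfl | rfl | rfl
      · exact hsub (Or.inl (by simp [hE8]))
      · exact hsub (Or.inr (by simp))
      · exact hsub (Or.inr (by simp))
      · exact hsub (Or.inl (by simp [hE8]))
      · exact hsub (Or.inl (by simp [hE8]))
      · exact hsub (Or.inl (by simp [hE8]))
      · exact hsub (Or.inl (by simp [hE8]))
    have halg : ∀ x ∈ ({(τ : ℂ), 2 * (π : ℂ) * I} : Set ℂ), IsAlgebraic (adjoin ℚ E8) x := by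
      intro x hx
      simp only [Set.mem_insert_iff, Set.mem_singleton_iff] at hx
      rcases hx with rfl | rfl
      · exact isAlgebraic_tau_adjoin_twoNome τ
      · exact isAlgebraic_twoPiI_adjoin_twoNome τ
    calc Algebra.trdeg ℚ ↥(adjoin ℚ S7)
        ≤ Algebra.trdeg ℚ ↥(adjoin ℚ (E8 ∪ {(τ : ℂ), 2 * (π : ℂ) * I})) :=
          trdeg_le_of_injective (inclusion hle) (inclusion_injective hle)
      _ = Algebra.trdeg ℚ ↥(adjoin ℚ E8) :=
          Literature.Barriers.Schanuel.trdeg_adjoin_union_eq_of_isAlgebraic_adjoin E8 _ halg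

/-- **The two-nome statement in crux coordinates**: "`6 ≤ trdeg ℚ(eight)` for every non-quadratic
`τ ∈ ℍ`" (the line's stub `stub_twoNomeS`) is EQUIVALENT to "`6 ≤ trdeg ℚ(2πi, τ, q, P, Q, R, q')`
for every non-quadratic `τ ∈ ℍ`", i.e. to the crux's six generators plus the partner nome carrying
six independent numbers — the crux plus one exponential, never less. -/
theorem twoNome_iff_six_insert_partner :
    (∀ τ : ℂ, 0 < τ.im → (∀ b c : ℚ, τ ^ 2 + (b : ℂ) * τ + (c : ℂ) ≠ 0) →
      (6 : Cardinal) ≤ Algebra.trdeg ℚ ↥(adjoin ℚ ({cexp (2 * π * I * τ),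
        ramanujanP (cexp (2 * π * I * τ)), ramanujanQ (cexp (2 * π * I * τ)),
        ramanujanR (cexp (2 * π * I * τ)), cexp (2 * π * I * (-τ⁻¹)),
        ramanujanP (cexp (2 * π * I * (-τ⁻¹))), ramanujanQ (cexp (2 * π * I * (-τ⁻¹))),
        ramanujanR (cexp (2 * π * I * (-τ⁻¹)))} : Set ℂ))) ↔
    (∀ τ : ℂ, 0 < τ.im → (∀ b c : ℚ, τ ^ 2 + (b : ℂ) * τ + (c : ℂ) ≠ 0) →
      (6 : Cardinal) ≤ Algebra.trdeg ℚ ↥(adjoin ℚ (insert (cexp (2 * π * I * (-τ⁻¹)))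
        ({2 * (π : ℂ) * I, τ, cexp (2 * π * I * τ), ramanujanP (cexp (2 * π * I * τ)),
          ramanujanQ (cexp (2 * π * I * τ)), ramanujanR (cexp (2 * π * I * τ))} : Set ℂ)))) := by
  constructor
  · intro h τ hτ hnq
    rw [← trdeg_twoNome_eq ⟨τ, hτ⟩]
    exact h τ hτ hnq
  · intro h τ hτ hnq
    rw [trdeg_twoNome_eq ⟨τ, hτ⟩]
    exact h τ hτ hnq

end Summit.Schanuel.Schanuel.Theorems.TateNomesTateLocusGPCOne

end
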